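import Summits.RiemannHypothesis.RiemannHypothesis.Theorems.LiTailLaguerreGammaTailWeights
import Summits.RiemannHypothesis.RiemannHypothesis.Theorems.LiPrimeEchoWindowAdjust
import Summits.RiemannHypothesis.RiemannHypothesis.Theorems.LiAsymptoticSmoothReplace
import Summits.RiemannHypothesis.RiemannHypothesis.Theorems.LiAsymptoticSmoothCuts
import Mathlib.Analysis.Complex.CauchyIntegral
import HarnessLib

/-!
# RiemannHypothesis / LiTailLaguerre — crux K3′ `LiGammaTailShift`, part 2: the Cauchy shift on the half-strip (RH-FREE)

RH-FREE [rh-li-eng-2 g4; binder K3′ of round 7].  Route `Theses/LiTailLaguerre.lean` (rung «Li TAIL–LAGUERRE LAW»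
`LiTheory.LiZeroTailLaguerre`, L-P(P1-tail); dossier `theory/route/r7`), item `LiGammaTailShift` (stmt-RiemannHypothesis-19704).
With `G̃_n(w) = (−½ log π + ½ ψ(w/2))(2 − k_n(w))` (part 1, `GammaTail.coGammaIntegrand`):

* the smooth-tail integrand `f_n(t) ϑ'(t) = liWindowWeight n t · liGammaDensity t` is continuous on `(0, ∞)`, bounded by
  `n²/(2t²)·(½ log t + 3)` for `t ≥ 1` (`SmoothReplace.liWindowWeight_le_sq`, `WindowAdjust.abs_liGammaDensity_le`), hence
  INTEGRABLE on `Ioi T` for `T ≥ 1` (`SmoothCuts.integral_log_div_sq`, `integrableOn_Ioi_rpow_of_lt`), and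
  `(2/π)∫_T^{Y} f_n ϑ' → liSmoothTail n T` as `Y → ∞`;
* CAUCHY on `[1/2, 3/2] × [T, Y]` (`Complex.integral_boundary_rect_eq_zero_of_differentiableOn`; no pole above height `0`):
  `(1/π) Re ∫_T^Y G̃_n(3/2 + iy) dy − (2/π) ∫_T^Y f_n ϑ' = (1/π) Im(∫_{1/2}^{3/2} G̃_n(x + iY) dx − ∫_{1/2}^{3/2} G̃_n(x + iT) dx)`,
  because on the critical line `Re G̃_n(½ + it) = 2 f_n(t) ϑ'(t)` (part 1);
* `Y → ∞` along `Y_k = T + n + k`: the right edge tends to `liGammaTail n T` (eng g5's `TailContour.tendsto_pieces`), the top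
  connector is `≤ (½ log(Y + 4) + 5)·2ne/Y ≤ 12ne·log²(Y + 4)/Y → 0` (part 1 + `TailContour.tendsto_log_sq_div`), so
  **`liGammaTail n T − liSmoothTail n T = −(1/π) Im gammaConnector n T`** (`T ≥ 1`), where
  `gammaConnector n T = ∫_{1/2}^{3/2} G̃_n(x + iT) dx` is the connector at the cut; in particular
  `|liGammaTail n T − liSmoothTail n T| ≤ (1/π)‖gammaConnector n T‖` — the registered skeleton stub `stub_gamma_cauchy` of K3′
  (`theory/route/r7/bc`, `LiGammaTailShift.Birth.Sig.stub_gamma_cauchy`, same body).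

Template: the PROVED `GammaShift.gammaEdge_sub_smooth_eq` (route LiPrimeEcho, finite window).  Nothing about zeros; nothing
here bears on the truth of RH.
-/

noncomputable section

-- D-0017: `Summit.<S>.<S>.…` is the designed namespace of a single-problem summit.
set_option linter.dupNamespace false

open Complex MeasureTheory intervalIntegral Set Filter
open scoped Real Interval Topology

namespace Summit.RiemannHypothesis.RiemannHypothesis.Theorems.LiTheory

open Literature.NumberTheory.LFunctions Literature.NumberTheory.LFunctions.SchoenfeldBound

namespace GammaTail

/-! ### The smooth-tail integrand is integrable on `Ioi T` -/

/-- `t ↦ f_n(t) ϑ'(t)` is continuous on `(0, ∞)`. -/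
theorem continuousOn_smoothIntegrand (n : ℕ) :
    ContinuousOn (fun t ↦ liWindowWeight n t * liGammaDensity t) (Ioi 0) := by
  have hθ : ContinuousOn liZeroAngle (Ioi 0) := fun t ht ↦
    (hasDerivAt_liZeroAngle (ne_of_gt (mem_Ioi.1 ht))).continuousAt.continuousWithinAt
  have hw : ContinuousOn (fun t ↦ liWindowWeight n t) (Ioi 0) := by
    have e : (fun t ↦ liWindowWeight n t) = fun t ↦ 1 - Real.cos (n * liZeroAngle t) := by funext t; rfl
    rw [e]
    exact continuousOn_const.sub (Real.continuous_cos.comp_continuousOn (continuousOn_const.mul hθ))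
  have hϑ : Continuous liGammaDensity := by
    have : liGammaDensity = riemannSiegelThetaDeriv := funext WindowAdjust.liGammaDensity_eq
    rw [this]; exact continuous_riemannSiegelThetaDeriv_holds
  exact hw.mul hϑ.continuousOn

/-- `|f_n(t) ϑ'(t)| ≤ (n²/4)·log t/t² + (3n²/2)·t^{−2}` for `t ≥ 1` (`0 ≤ f_n ≤ n²/(2t²)`, `|ϑ'| ≤ ½ log t + 3`). -/
theorem norm_smoothIntegrand_le (n : ℕ) {t : ℝ} (ht : 1 ≤ t) :
    ‖liWindowWeight n t * liGammaDensity t‖ ≤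
      (n : ℝ) ^ 2 / 4 * (Real.log t / t ^ 2) + 3 / 2 * (n : ℝ) ^ 2 * t ^ (-(2 : ℝ)) := by
  have ht0 : 0 < t := by linarith
  rw [Real.norm_eq_abs, abs_mul, abs_of_nonneg (SmoothReplace.liWindowWeight_mem n t).1]
  have hw := SmoothReplace.liWindowWeight_le_sq n ht0
  have hg := WindowAdjust.abs_liGammaDensity_le ht
  have hlog0 : 0 ≤ Real.log t := Real.log_nonneg ht
  have hrpow : t ^ (-(2 : ℝ)) = 1 / t ^ 2 := by
    rw [Real.rpow_neg ht0.le, Real.rpow_two, one_div]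
  rw [hrpow]
  calc liWindowWeight n t * |liGammaDensity t| ≤ (n : ℝ) ^ 2 / (2 * t ^ 2) * (Real.log t / 2 + 3) :=
        mul_le_mul hw hg (abs_nonneg _) (by positivity)
    _ = (n : ℝ) ^ 2 / 4 * (Real.log t / t ^ 2) + 3 / 2 * (n : ℝ) ^ 2 * (1 / t ^ 2) := by
        field_simp
        ring

/-- **The smooth-tail integrand is integrable on `Ioi T`** for `T ≥ 1`. -/
theorem integrableOn_smoothIntegrand (n : ℕ) {T : ℝ} (hT : 1 ≤ T) :
    IntegrableOn (fun t ↦ liWindowWeight n t * liGammaDensity t) (Ioi T) := by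
  have hT0 : 0 < T := by linarith
  obtain ⟨hlog, -⟩ := SmoothCuts.integral_log_div_sq hT
  have hrpow : IntegrableOn (fun t : ℝ ↦ t ^ (-(2 : ℝ))) (Ioi T) := integrableOn_Ioi_rpow_of_lt (by norm_num) hT0
  have hmaj : IntegrableOn
      (fun t : ℝ ↦ (n : ℝ) ^ 2 / 4 * (Real.log t / t ^ 2) + 3 / 2 * (n : ℝ) ^ 2 * t ^ (-(2 : ℝ))) (Ioi T) :=
    (hlog.const_mul _).add (hrpow.const_mul _)
  have hmeas : AEStronglyMeasurable (fun t ↦ liWindowWeight n t * liGammaDensity t) (volume.restrict (Ioi T)) :=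
    ((continuousOn_smoothIntegrand n).mono (Ioi_subset_Ioi hT0.le)).aestronglyMeasurable measurableSet_Ioi
  refine Integrable.mono' hmaj hmeas ?_
  filter_upwards [ae_restrict_mem measurableSet_Ioi] with t ht
  exact norm_smoothIntegrand_le n (hT.trans (mem_Ioi.1 ht).le)

/-- `(2/π) ∫_T^{b k} f_n ϑ' → liSmoothTail n T` along any `b → ∞` (`T ≥ 1`). -/
theorem tendsto_smooth (n : ℕ) {T : ℝ} (hT : 1 ≤ T) {b : ℕ → ℝ} (hb : Tendsto b atTop atTop) :
    Tendsto (fun k ↦ 2 / Real.pi * ∫ t in T..b k, liWindowWeight n t * liGammaDensity t) atTop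
      (𝓝 (liSmoothTail n T)) := by
  have h := MeasureTheory.intervalIntegral_tendsto_integral_Ioi T (integrableOn_smoothIntegrand n hT) hb
  unfold liSmoothTail
  exact h.const_mul _

/-! ### Cauchy on the finite rectangle `[1/2, 3/2] × [T, Y]` -/

/-- For `0 < T ≤ Y`:
`(1/π) Re ∫_T^Y G̃_n(3/2 + iy) dy − (2/π) ∫_T^Y f_n ϑ' = (1/π) Im(∫_{1/2}^{3/2} G̃_n(x + iY) dx − ∫_{1/2}^{3/2} G̃_n(x + iT) dx)`. -/
theorem finite_shift (n : ℕ) {T Y : ℝ} (hT : 0 < T) (hTY : T ≤ Y) :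
    1 / Real.pi * (∫ y in T..Y, TailContour.gammaIntegrand n y).re
        - 2 / Real.pi * (∫ t in T..Y, liWindowWeight n t * liGammaDensity t) =
      1 / Real.pi * ((∫ x in (1 / 2 : ℝ)..(3 / 2 : ℝ), coGammaIntegrand n (x + Y * I)) -
        ∫ x in (1 / 2 : ℝ)..(3 / 2 : ℝ), coGammaIntegrand n (x + T * I)).im := by
  -- Cauchy on the rectangle with corners `1/2 + iT`, `3/2 + iY`
  have hC := Complex.integral_boundary_rect_eq_zero_of_differentiableOn (coGammaIntegrand n) (1 / 2 + T * I)
    (3 / 2 + Y * I) (by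
      have h1 : ((1 : ℂ) / 2 + T * I).re = 1 / 2 := by simp
      have h2 : ((3 : ℂ) / 2 + Y * I).re = 3 / 2 := by simp
      have h3 : ((1 : ℂ) / 2 + T * I).im = T := by simp
      have h4 : ((3 : ℂ) / 2 + Y * I).im = Y := by simp
      rw [h1, h2, h3, h4]
      exact differentiableOn_coGammaIntegrand n (by norm_num) (by norm_num) hT hTY)
  simp only [Complex.add_re, Complex.add_im, Complex.div_ofNat_re, Complex.one_re, Complex.mul_re, Complex.ofReal_re,
    Complex.I_re, Complex.ofReal_im, Complex.I_im, Complex.div_ofNat_im, Complex.one_im, Complex.mul_im,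
    Complex.re_ofNat, Complex.im_ofNat] at hC
  norm_num at hC
  -- `hC : ∫bot − ∫top + I ∫R − I ∫L = 0`
  set IR := ∫ y in T..Y, coGammaIntegrand n (3 / 2 + y * I) with hIR
  set IL := ∫ y in T..Y, coGammaIntegrand n (1 / 2 + y * I) with hIL
  set Itop := ∫ x in (1 / 2 : ℝ)..(3 / 2 : ℝ), coGammaIntegrand n (x + Y * I) with hItop
  set Ibot := ∫ x in (1 / 2 : ℝ)..(3 / 2 : ℝ), coGammaIntegrand n (x + T * I) with hIbot
  have hRL : IR = IL - I * (Itop - Ibot) := by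
    have hI : I * I = -1 := Complex.I_mul_I
    linear_combination (-I) * hC + (IR - IL) * hI
  -- the right edge is eng g5's gamma integrand
  have hedge : (∫ y in T..Y, TailContour.gammaIntegrand n y) = IR := by
    rw [hIR]; rfl
  -- the left edge is twice the smooth-tail integrand
  have hleft : IL.re = ∫ y in T..Y, 2 * liWindowWeight n y * liGammaDensity y := by
    have hcont : ContinuousOn (fun y : ℝ ↦ coGammaIntegrand n (1 / 2 + y * I)) (uIcc T Y) := by
      refine continuousOn_of_forall_continuousAt fun y hy ↦ ?_
      rw [uIcc_of_le hTY] at hy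
      have hy0 : 0 < y := hT.trans_le hy.1
      have hd := differentiableAt_coGammaIntegrand n (w := 1 / 2 + y * I) (by simp) (by simp; exact hy0.ne')
      have hc2 : Continuous fun y : ℝ ↦ (1 : ℂ) / 2 + y * I := by fun_prop
      show ContinuousAt ((coGammaIntegrand n) ∘ fun y : ℝ ↦ (1 : ℂ) / 2 + y * I) y
      exact ContinuousAt.comp hd.continuousAt hc2.continuousAt
    have hi : IntervalIntegrable (fun y : ℝ ↦ coGammaIntegrand n (1 / 2 + y * I)) volume T Y :=
      hcont.intervalIntegrable
    have hcomm := ContinuousLinearMap.intervalIntegral_comp_comm Complex.reCLM hi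
    simp only [Complex.reCLM_apply] at hcomm
    rw [hIL, ← hcomm]
    refine intervalIntegral.integral_congr fun y hy ↦ ?_
    rw [uIcc_of_le hTY] at hy
    exact re_coGammaIntegrand_half_line n (hT.trans_le hy.1).ne'
  have hsmooth : 2 / Real.pi * (∫ t in T..Y, liWindowWeight n t * liGammaDensity t) = 1 / Real.pi * IL.re := by
    rw [hleft, ← intervalIntegral.integral_const_mul, ← intervalIntegral.integral_const_mul]
    refine intervalIntegral.integral_congr fun y _ ↦ ?_
    ring
  rw [hedge, hsmooth, hRL]
  simp only [Complex.sub_re, Complex.mul_re, Complex.I_re, Complex.I_im, zero_mul, one_mul, zero_sub]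
  ring

/-! ### The limit `Y → ∞` -/

/-- The connector at the cut: `∫_{1/2}^{3/2} G̃_n(x + iT) dx` (the registered skeleton's `gammaConnector`, same body). -/
def gammaConnector (n : ℕ) (T : ℝ) : ℂ := ∫ x in (1 / 2 : ℝ)..(3 / 2 : ℝ), coGammaIntegrand n (x + T * I)

/-- **The Cauchy shift on the half-strip** (`T ≥ 1`): `liGammaTail n T − liSmoothTail n T = −(1/π) Im gammaConnector n T`. -/
theorem liGammaTail_sub_liSmoothTail_eq (n : ℕ) {T : ℝ} (hT : 1 ≤ T) :
    liGammaTail n T - liSmoothTail n T = -(1 / Real.pi) * (gammaConnector n T).im := by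
  have hT0 : 0 < T := by linarith
  -- heights `b k = T + n + k → ∞` (`b k ≥ T ≥ 1`, `(b k)² ≥ n`)
  set b : ℕ → ℝ := fun k ↦ T + n + k with hb
  have hbT : ∀ k, T ≤ b k := fun k ↦ by
    simp only [hb]; linarith [Nat.cast_nonneg (α := ℝ) k, Nat.cast_nonneg (α := ℝ) n]
  have hb1 : ∀ k, 1 ≤ b k := fun k ↦ hT.trans (hbT k)
  have hbn : ∀ k, (n : ℝ) ≤ b k ^ 2 := fun k ↦ by
    have h1 : (n : ℝ) ≤ b k := by simp only [hb]; linarith [Nat.cast_nonneg (α := ℝ) k]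
    have h2 : 1 ≤ b k := hb1 k
    nlinarith
  have hbtend : Tendsto b atTop atTop := by
    refine tendsto_atTop_mono (fun k ↦ ?_) tendsto_natCast_atTop_atTop
    simp only [hb]; linarith [Nat.cast_nonneg (α := ℝ) n]
  -- the finite identities
  have hident : ∀ k, 1 / Real.pi * (∫ y in T..b k, TailContour.gammaIntegrand n y).re
      - 2 / Real.pi * (∫ t in T..b k, liWindowWeight n t * liGammaDensity t)
      = 1 / Real.pi * (gammaConnector n (b k)).im - 1 / Real.pi * (gammaConnector n T).im := by
    intro k
    rw [finite_shift n hT0 (hbT k)]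
    unfold gammaConnector
    rw [Complex.sub_im]
    ring
  -- the left side tends to `liGammaTail − liSmoothTail`
  obtain ⟨-, hG, -⟩ := TailContour.tendsto_pieces n hT hbtend
  have hS := tendsto_smooth n hT hbtend
  have hL : Tendsto (fun k ↦ 1 / Real.pi * (∫ y in T..b k, TailContour.gammaIntegrand n y).re
      - 2 / Real.pi * (∫ t in T..b k, liWindowWeight n t * liGammaDensity t)) atTop
      (𝓝 (liGammaTail n T - liSmoothTail n T)) := hG.sub hS
  -- the top connector tends to `0`
  have htop : Tendsto (fun k ↦ 1 / Real.pi * (gammaConnector n (b k)).im) atTop (𝓝 0) := by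
    have hbound : ∀ k, ‖1 / Real.pi * (gammaConnector n (b k)).im‖ ≤
        (12 * (n * Real.exp 1)) * Real.log (b k + 4) ^ 2 / b k := by
      intro k
      have h1 : ‖gammaConnector n (b k)‖ ≤ (Real.log (b k + 4) / 2 + 5) * (2 * (n * Real.exp 1 / b k)) :=
        norm_connector_le_div n (hb1 k) (hbn k)
      have him : |(gammaConnector n (b k)).im| ≤ ‖gammaConnector n (b k)‖ := Complex.abs_im_le_norm _
      have hπ : |1 / Real.pi| ≤ 1 := by
        rw [abs_of_pos (by positivity), div_le_one Real.pi_pos]; linarith [Real.pi_gt_three]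
      have hlog1 : 1 ≤ Real.log (b k + 4) := by
        rw [Real.le_log_iff_exp_le (by linarith [hb1 k])]
        have := Real.exp_one_lt_d9; linarith [hb1 k]
      have hfac : Real.log (b k + 4) / 2 + 5 ≤ 6 * Real.log (b k + 4) ^ 2 := by nlinarith
      have hpos : 0 ≤ 2 * (n * Real.exp 1 / b k) := by
        have := hb1 k; positivity
      rw [Real.norm_eq_abs, abs_mul]
      calc |1 / Real.pi| * |(gammaConnector n (b k)).im| ≤ 1 * ‖gammaConnector n (b k)‖ :=
            mul_le_mul hπ him (abs_nonneg _) zero_le_one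
        _ ≤ (Real.log (b k + 4) / 2 + 5) * (2 * (n * Real.exp 1 / b k)) := by rw [one_mul]; exact h1
        _ ≤ 6 * Real.log (b k + 4) ^ 2 * (2 * (n * Real.exp 1 / b k)) := mul_le_mul_of_nonneg_right hfac hpos
        _ = (12 * (n * Real.exp 1)) * Real.log (b k + 4) ^ 2 / b k := by ring
    exact squeeze_zero_norm hbound (TailContour.tendsto_log_sq_div hbtend (12 * (n * Real.exp 1)))
  have hR : Tendsto (fun k ↦ 1 / Real.pi * (gammaConnector n (b k)).im - 1 / Real.pi * (gammaConnector n T).im)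
      atTop (𝓝 (0 - 1 / Real.pi * (gammaConnector n T).im)) := htop.sub_const _
  have hEq := tendsto_nhds_unique (hL.congr hident) hR
  rw [hEq]
  ring

/-- Hence, for `T ≥ 1`: `|liGammaTail n T − liSmoothTail n T| ≤ (1/π)‖gammaConnector n T‖` — the registered skeleton stub
`stub_gamma_cauchy` of K3′ (for every `n`). -/
theorem abs_liGammaTail_sub_liSmoothTail_le (n : ℕ) {T : ℝ} (hT : 1 ≤ T) :
    |liGammaTail n T - liSmoothTail n T| ≤ 1 / Real.pi * ‖gammaConnector n T‖ := by
  rw [liGammaTail_sub_liSmoothTail_eq n hT, abs_mul, abs_neg, abs_of_pos (by positivity : (0 : ℝ) < 1 / Real.pi)]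
  exact mul_le_mul_of_nonneg_left (Complex.abs_im_le_norm _) (by positivity)

/-- The connector at the cut is `≤ (½ log(T + 4) + 5)(3 + e^{n/T²})` in norm (`T ≥ 1`; part 1). -/
theorem norm_gammaConnector_le (n : ℕ) {T : ℝ} (hT : 1 ≤ T) :
    ‖gammaConnector n T‖ ≤ (Real.log (T + 4) / 2 + 5) * (3 + Real.exp (n / T ^ 2)) :=
  norm_connector_le n hT

end GammaTail

end Summit.RiemannHypothesis.RiemannHypothesis.Theorems.LiTheory

end
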